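import Summits.QuantumAdvantage.QuantumAdvantage.Theorems.SosSandwichTransferPBDescentDefs
import HarnessLib

/-!
# Route `SosSandwich`, crux `TransferPB` (stmt-QuantumAdvantage-15238): STRING-LEVEL definitions of the machine's walk (machine half of stub `stub_pbOracleSimulation`)

`Defs` file (D-0016 convention; no theorem proved here). The transcript machine of the machine half never
handles relevant-bit INDICES `Fin (numOracleBits F x)`: its whole interaction is a function of the input `x`,
the answer function `g` (queries `true :: instance`), the oracle `A` (queries `false :: string`), an upper bound
`W` for the width and a round budget `D`. This file fixes that interaction as pure functions on STRING paths
`π : List (List Bool × Bool)` (revealed string, revealed bit):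

* `encPathS`, `encBlockS`, `encSingleS`, `encMeanS` — the instance encodings at a string path (they agree with
  `encPath`/`encBlock`/`encSingleStr`/`encMean` at `strPath ρ`, `Theorems/SosSandwichTransferPBDescentWalk.lean`);
* `strPath F x ρ` — the string path of an index path;
* `strWalk g x W inA D π` — the walk: at most `D` times, run the descent (`descentPick` of
  `Theorems/SosSandwichTransferPBDescentDefs.lean`) at the current path and, if it picks a string `u`, reveal
  the bit `inA u` and extend the path; stop at a refusal;
* `meanCount g x π` — the number of MEAN tests `j = 1, …, 40` answered `true` at the final path (the machine
  outputs `[20 ≤ meanCount]`, i.e. `[meanCount/40 ≥ 1/2]`).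

Sources: S. Aaronson, A. Ambainis, Theory Comput. 10 (2014), proof of Thm. 23 (p. 14); cell record
`Cruxes/TransferPB/Lines/birth-machine-spec.md`.
-/

-- D-0017: single-conjunct summit ⇒ the duplicate `QuantumAdvantage.QuantumAdvantage` is mandated.
set_option linter.dupNamespace false

noncomputable section

namespace Summit.QuantumAdvantage.QuantumAdvantage.Cruxes.TransferPB.Birth

open Finset Literature.Computability.Cryptography Literature.Computability.Complexity
  Literature.Computability.QuantumComplexity Literature.Computability.QuantumComplexity.ClassicalSimulation

namespace SimTreePB

/-- Serialised STRING path: the list of (revealed bit :: revealed string) blocks, `boolPair`-nested. -/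
def encPathS : List (List Bool × Bool) → List Bool
  | [] => []
  | e :: π => boolPair (e.2 :: e.1) (encPathS π)

/-- BLOCK instance `⟨x, π, u⟩` at a string path (tag `00`). -/
def encBlockS (x : List Bool) (π : List (List Bool × Bool)) (u : List Bool) : List Bool :=
  boolPair x (boolPair (encPathS π) (false :: false :: u))

/-- SINGLE instance `⟨x, π, u⟩` at a string path (tag `01`). -/
def encSingleS (x : List Bool) (π : List (List Bool × Bool)) (u : List Bool) : List Bool :=
  boolPair x (boolPair (encPathS π) (false :: true :: u))

/-- MEAN instance `⟨x, π, j⟩` at a string path (tag `1`, `j` in unary). -/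
def encMeanS (x : List Bool) (π : List (List Bool × Bool)) (j : ℕ) : List Bool :=
  boolPair x (boolPair (encPathS π) (true :: List.replicate j true))

/-- The string path of an index path. -/
def strPath (F : QCircuitFamily cliffordT) (x : List Bool) (ρ : List (Fin (numOracleBits F x) × Bool)) :
    List (List Bool × Bool) :=
  ρ.map fun e => (bitString F x e.1, e.2)

/-- **The machine's walk** with answer function `g`, input `x`, width bound `W`, oracle bits `inA` and budget
`D`, from the string path `π`: run the descent at the current path; on a pick `u` reveal `inA u` and continue
on the extended path; on a refusal (or when the budget is exhausted) stop and return the path reached.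
[cite: AaronsonAmbainis2014, Thm. 23 (proof, p. 14)] -/
def strWalk (g : List Bool → Bool) (x : List Bool) (W : ℕ) (inA : List Bool → Bool) :
    ℕ → List (List Bool × Bool) → List (List Bool × Bool)
  | 0, π => π
  | D + 1, π =>
    match descentPick (fun u => g (encBlockS x π u)) (fun u => g (encSingleS x π u)) W (π.map Prod.fst) with
    | none => π
    | some u => strWalk g x W inA D (π ++ [(u, inA u)])

/-- The number of MEAN tests `j = 1, …, 40` answered `true` at the string path `π`. -/
def meanCount (g : List Bool → Bool) (x : List Bool) (π : List (List Bool × Bool)) : ℕ :=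
  ((Icc 1 40).filter fun j => g (encMeanS x π j) = true).card

end SimTreePB

end Summit.QuantumAdvantage.QuantumAdvantage.Cruxes.TransferPB.Birth

end
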